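import Mathlib.Computability.TuringMachine.Tape
import Mathlib.Data.Finsupp.Basic
import Mathlib.Analysis.Complex.Basic
import Mathlib.Computability.Encoding
import Mathlib.Computability.Language
import Literature.Computability.Complexity.TimeBounds
import Literature.Computability.Complexity.BoolEncodings
import Literature.Computability.Complexity.Classes
import Literature.Computability.Complexity.ComputableReal
import HarnessLib

-- provenance: harness21/H21/H21/Prelude/CryptoQuantFine/QuantumTuringMachine.lean @ e1a0f7a (interim HEAD d8f2665); M5 mechanical rewrite
/-!
# Quantum Turing machines and `BQP` (trunk CryptoQuantFine, outline Q8)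

This file formalises single-tape quantum Turing machines (QTMs) in the sense of
Bernstein–Vazirani, their linear time evolution on finitely supported superpositions of
configurations, well-formedness (the evolution preserves the `ℓ²` length), fixed-time acceptance
probabilities, and the class `BQP` defined via QTMs whose amplitudes lie in a prescribed set of
complex numbers (polynomial-time computable numbers for `BQPQTM`; the finite
Adleman–DeMarrais–Huang set `{0, ±1, ±3/5, ±4/5}` is `adhAmplitudes`).

## Sources

* E. Bernstein, U. Vazirani, *Quantum complexity theory*, SIAM J. Comput. 26 (1997),
  Definitions 3.2.1–3.2.3, §6 (poly-time computable amplitudes), §8 (`BQP`), Appendix B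
  (a QTM whose time evolution is an isometry is automatically unitary).
* L. Adleman, J. DeMarrais, M.-D. Huang, *Quantum computability*, SIAM J. Comput. 26 (1997)
  (amplitudes in `{0, ±3/5, ±4/5, ±1}` suffice).
* K.-I. Ko, *Complexity Theory of Real Functions* (1991), Def. 2.1 (poly-time computable reals).

## Mathlib / H21 reuse

Tapes are Mathlib's `Turing.Tape` (`Tape.mk₁`, `Tape.write`, `Tape.move`, `Tape.head`,
`Turing.Dir`); superpositions are `Finsupp`s `M.Cfg →₀ ℂ`. Mathlib has no quantum Turing
machine (searched `Quantum`, `QTM`, `unitary` under `Computability/`). Polynomial time is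
`Literature.Computability.Complexity.PolyTimeComputable` with the encodings `Computability.unaryEncodeNat` (Mathlib) and
`Literature.Computability.Complexity.encodingIntBool`; computable reals are `Literature.Computability.Complexity.IsComputableReal`.

## Design choices

* `QTM` bundles its (finite) state and tape alphabets as fields `Λ Γ : Type`, so `QTM : Type 1`
  and `∃ M : QTM, …` makes sense in `BQPQTMWith`. The input alphabet `Bool` is embedded into the
  tape alphabet by the field `embed`; the blank symbol is `default : Γ`.
* `QTM.evolve` writes out the two head directions explicitly: Mathlib has no
  `Fintype Turing.Dir` instance and we add no instance on a Mathlib type.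
* Well-formedness is stated as preservation of the squared `ℓ²` norm on finitely supported
  superpositions (BV Def. 3.2.3); by BV Appendix B this already forces unitarity of the evolution
  on `ℓ²(Cfg)`, so length preservation suffices.
* Acceptance is measured at a fixed polynomial time `p(|x|)` by observing the control state
  (BV's stationary normal form remark, §1/§8), avoiding halting-time bookkeeping.
* `IsPolyTimeComputableReal` uses dyadic names `f n / 2^n` computable from `1ⁿ` in polynomial
  time with the SAME error convention `(1/2)^n` as `Literature.Computability.Complexity.IsComputableReal`
  (`ComputableReal.lean:49`), so `IsPolyTimeComputableReal.isComputableReal` is immediate modulo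
  "poly-time ⇒ computable".
-/

namespace Literature.Computability.Cryptography

open Turing _root_.Computability Complexity
open scoped BigOperators

/-! ### Machines, configurations, evolution -/

/-- A (single-tape) *quantum Turing machine* (Bernstein–Vazirani 1997, Def. 3.2.2): a finite
control-state set `Λ`, a finite tape alphabet `Γ` with blank `default`, start and accept states,
an embedding of the input alphabet `Bool` into `Γ`, and a transition amplitude function
`δ p a q b d ∈ ℂ` = amplitude of "in state `p` reading `a`, write `b`, enter `q`, move `d`". [cite: BernsteinVazirani1997, Def. 3.2.2] -/
structure QTM where
  /-- Control states. -/
  Λ : Type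
  /-- Tape alphabet. -/
  Γ : Type
  [finΛ : Fintype Λ]
  [decΛ : DecidableEq Λ]
  [finΓ : Fintype Γ]
  [decΓ : DecidableEq Γ]
  /-- The blank symbol is `default`. -/
  [inhΓ : Inhabited Γ]
  /-- Initial control state. -/
  start : Λ
  /-- Accepting control state (observed at measurement time). -/
  accept : Λ
  /-- Embedding of input bits into the tape alphabet. -/
  embed : Bool → Γ
  /-- Transition amplitudes `δ p a q b d`. -/
  δ : Λ → Γ → Λ → Γ → Dir → ℂ

attribute [instance] QTM.finΛ QTM.decΛ QTM.finΓ QTM.decΓ QTM.inhΓ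

namespace QTM

/-- A configuration of a QTM: control state and tape (with head position), as in
Bernstein–Vazirani 1997, Def. 3.2.2. [cite: BernsteinVazirani1997, Def. 3.2.2] -/
structure Cfg (M : QTM) where
  /-- Current control state. -/
  q : M.Λ
  /-- Current tape. -/
  tape : Tape M.Γ

/-- The initial configuration on input `x : List Bool`: start state, head on the first input
symbol (Bernstein–Vazirani 1997, Def. 3.2.2; Mathlib `Turing.Tape.mk₁`). [cite: BernsteinVazirani1997, Def. 3.2.2] -/
def init (M : QTM) (x : List Bool) : M.Cfg :=
  ⟨M.start, Tape.mk₁ (x.map M.embed)⟩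

/-- One step of the linear time-evolution operator of a QTM on finitely supported superpositions
of configurations (Bernstein–Vazirani 1997, Def. 3.2.2): each basis configuration `c` with
amplitude `a` contributes `a * δ c.q c.head q' b d` to the configuration obtained by writing `b`,
entering `q'` and moving in direction `d`. The two directions are written out (Mathlib has no
`Fintype Turing.Dir`). [cite: BernsteinVazirani1997, Def. 3.2.2] -/
noncomputable def evolve (M : QTM) (ψ : M.Cfg →₀ ℂ) : M.Cfg →₀ ℂ :=
  ψ.sum fun c a => ∑ q' : M.Λ, ∑ b : M.Γ,
    ((a * M.δ c.q c.tape.head q' b Dir.left) •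
        Finsupp.single (⟨q', (c.tape.write b).move Dir.left⟩ : M.Cfg) (1 : ℂ) +
      (a * M.δ c.q c.tape.head q' b Dir.right) •
        Finsupp.single (⟨q', (c.tape.write b).move Dir.right⟩ : M.Cfg) (1 : ℂ))

/-- The squared `ℓ²` norm `∑ ‖ψ c‖²` of a finitely supported superposition
(Bernstein–Vazirani 1997, §3.2). [cite: BernsteinVazirani1997, §3.2] -/
noncomputable def normSq (M : QTM) (ψ : M.Cfg →₀ ℂ) : ℝ :=
  ψ.sum fun _ a => ‖a‖ ^ 2

/-- A QTM is *well-formed* if its time evolution preserves `ℓ²` length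
(Bernstein–Vazirani 1997, Def. 3.2.3). By BV 1997, Appendix B, a QTM whose evolution is an
isometry is automatically unitary, so length preservation is the right condition. [cite: BernsteinVazirani1997, Def. 3.2.3] -/
def IsWellFormed (M : QTM) : Prop :=
  ∀ ψ : M.Cfg →₀ ℂ, M.normSq (M.evolve ψ) = M.normSq ψ

/-- The set of transition amplitudes used by `M` (Bernstein–Vazirani 1997, §6;
Adleman–DeMarrais–Huang 1997). [cite: BernsteinVazirani1997, §6] -/
def amplitudes (M : QTM) : Set ℂ :=
  {z | ∃ p a q b d, M.δ p a q b d = z}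

/-- The superposition reached after `t` steps on input `x`
(Bernstein–Vazirani 1997, Def. 3.2.2). [cite: BernsteinVazirani1997, Def. 3.2.2] -/
noncomputable def stateAt (M : QTM) (x : List Bool) (t : ℕ) : M.Cfg →₀ ℂ :=
  M.evolve^[t] (Finsupp.single (M.init x) 1)

/-- The probability of observing the accepting control state when the machine is measured after
exactly `t` steps on input `x` (Bernstein–Vazirani 1997, §3.2 and the stationary normal-form
remark of §1/§8). [cite: BernsteinVazirani1997, §3.2 and the stationary normal-form rema] -/
noncomputable def acceptProbAt (M : QTM) (x : List Bool) (t : ℕ) : ℝ :=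
  (M.stateAt x t).sum fun c a => if c.q = M.accept then ‖a‖ ^ 2 else 0

/-! ### API -/

variable (M : QTM)

/-- The evolution operator is linear; in particular it sends `0` to `0`
(Bernstein–Vazirani 1997, Def. 3.2.2). [cite: BernsteinVazirani1997, Def. 3.2.2] -/
@[simp] theorem evolve_zero : M.evolve 0 = 0 := by
  simp [evolve]

/-- Unfolding `evolve` on a basis configuration (Bernstein–Vazirani 1997, Def. 3.2.2). [cite: BernsteinVazirani1997, Def. 3.2.2] -/
theorem evolve_single (c : M.Cfg) (a : ℂ) :
    M.evolve (Finsupp.single c a) = ∑ q' : M.Λ, ∑ b : M.Γ,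
      ((a * M.δ c.q c.tape.head q' b Dir.left) •
          Finsupp.single (⟨q', (c.tape.write b).move Dir.left⟩ : M.Cfg) (1 : ℂ) +
        (a * M.δ c.q c.tape.head q' b Dir.right) •
          Finsupp.single (⟨q', (c.tape.write b).move Dir.right⟩ : M.Cfg) (1 : ℂ)) := by
  unfold evolve
  rw [Finsupp.sum_single_index]
  simp

/-- The squared norm is nonnegative (Bernstein–Vazirani 1997, §3.2). [cite: BernsteinVazirani1997, §3.2] -/
theorem normSq_nonneg (ψ : M.Cfg →₀ ℂ) : 0 ≤ M.normSq ψ :=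
  Finset.sum_nonneg fun _ _ => by positivity

/-- The squared norm of a basis state with amplitude `a` is `‖a‖²`
(Bernstein–Vazirani 1997, §3.2). [cite: BernsteinVazirani1997, §3.2] -/
@[simp] theorem normSq_single (c : M.Cfg) (a : ℂ) :
    M.normSq (Finsupp.single c a) = ‖a‖ ^ 2 := by
  unfold normSq
  rw [Finsupp.sum_single_index]
  simp

variable {M}

/-- A well-formed QTM stays normalised: `‖stateAt x t‖² = 1` for all `t`
(Bernstein–Vazirani 1997, Def. 3.2.3). [cite: BernsteinVazirani1997, Def. 3.2.3] -/
theorem IsWellFormed.normSq_stateAt (h : M.IsWellFormed) (x : List Bool) (t : ℕ) :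
    M.normSq (M.stateAt x t) = 1 := by
  induction t with
  | zero => simp [stateAt]
  | succ t ih =>
    unfold stateAt at ih ⊢
    rw [Function.iterate_succ_apply', h, ih]

variable (M)

/-- Acceptance probabilities are nonnegative (Bernstein–Vazirani 1997, §3.2). [cite: BernsteinVazirani1997, §3.2] -/
theorem acceptProbAt_nonneg (x : List Bool) (t : ℕ) : 0 ≤ M.acceptProbAt x t :=
  Finset.sum_nonneg fun _ _ => by positivity

variable {M}

/-- For a well-formed QTM acceptance probabilities are at most `1`
(Bernstein–Vazirani 1997, Def. 3.2.3). [cite: BernsteinVazirani1997, Def. 3.2.3] -/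
def acceptProbAt_le_one : Prop :=
  ∀ (h : M.IsWellFormed) (x : List Bool) (t : ℕ),
    M.acceptProbAt x t ≤ 1

end QTM

/-! ### Polynomial-time computable numbers -/

/-- A real number `x` is *polynomial-time computable* if some `f : ℕ → ℤ`, computable in
polynomial time from the unary input `1ⁿ` (output in the binary integer encoding
`Literature.Computability.Complexity.encodingIntBool`), gives dyadic approximations `|x - f n / 2^n| ≤ (1/2)^n`
(Ko 1991, Def. 2.1; Bernstein–Vazirani 1997, §6). Same `(1/2)^n` error convention as
`Literature.Computability.Complexity.IsComputableReal`. [cite: Ko1991, Def. 2.1] -/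
def IsPolyTimeComputableReal (x : ℝ) : Prop :=
  ∃ f : ℕ → ℤ, PolyTimeComputable unaryEncodeNat encodingIntBool.encode f ∧
    ∀ n : ℕ, |x - (f n : ℝ) / 2 ^ n| ≤ (1 / 2 : ℝ) ^ n

/-- A complex number is *polynomial-time computable* if its real and imaginary parts are
(Bernstein–Vazirani 1997, §6); mirrors `Literature.Computability.Complexity.IsComputableComplex`. [cite: BernsteinVazirani1997, §6] -/
def IsPolyTimeComputableComplex (z : ℂ) : Prop :=
  IsPolyTimeComputableReal z.re ∧ IsPolyTimeComputableReal z.im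

/-- The set of polynomial-time computable complex numbers, the amplitude set of
Bernstein–Vazirani's `BQP` (BV 1997, §6, §8). [cite: BV1997, §6  §8] -/
def polyTimeComputableComplex : Set ℂ := {z | IsPolyTimeComputableComplex z}

/-- Membership in `polyTimeComputableComplex` is `IsPolyTimeComputableComplex` (by definition). [folklore] -/
@[simp] theorem mem_polyTimeComputableComplex_iff (z : ℂ) :
    z ∈ polyTimeComputableComplex ↔ IsPolyTimeComputableComplex z :=
  Iff.rfl

/-- The Adleman–DeMarrais–Huang amplitude set `{0, ±1, ±3/5, ±4/5}`: QTMs with amplitudes in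
this finite set of rationals already capture `BQP` (Adleman–DeMarrais–Huang 1997, Thm. 5.2). [cite: AdlemanDeMarraisHuang1997, Thm. 5.2] -/
def adhAmplitudes : Set ℂ := {0, 1, -1, 3 / 5, -3 / 5, 4 / 5, -4 / 5}

/-- Rational numbers are polynomial-time computable reals (Ko 1991, §2.1). [cite: Ko1991, §2.1] -/
def IsPolyTimeComputableReal.ratCast : Prop :=
  ∀ (q : ℚ),
    IsPolyTimeComputableReal (q : ℝ)

/-- A polynomial-time computable real is computable in the sense of
`Literature.Computability.Complexity.IsComputableReal` (Ko 1991, §2.1; immediate from "poly-time ⇒ computable" since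
both notions use `(1/2)^n`-fast Cauchy names). [cite: Ko1991, §2.1] -/
def IsPolyTimeComputableReal.isComputableReal : Prop :=
  ∀ {x : ℝ} (h : IsPolyTimeComputableReal x),
    IsComputableReal x

/-- The Adleman–DeMarrais–Huang amplitudes are polynomial-time computable
(Adleman–DeMarrais–Huang 1997; Ko 1991, §2.1). [cite: AdlemanDeMarraisHuang1997] -/
def adhAmplitudes_subset_polyTimeComputableComplex : Prop :=
  adhAmplitudes ⊆ polyTimeComputableComplex

/-! ### `BQP` via quantum Turing machines -/

/-- `BQPQTMWith S`: languages decided with error `≤ 1/3` by a well-formed QTM with amplitudes in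
`S`, measured (control state observed) after exactly `p(|x|)` steps for some polynomial `p`
(Bernstein–Vazirani 1997, Def. 3.2.3 and §8; Adleman–DeMarrais–Huang 1997 for the dependence on
the amplitude set). [cite: BernsteinVazirani1997, Def. 3.2.3 and §8] -/
def BQPQTMWith (S : Set ℂ) : Set (Language Bool) :=
  {L | ∃ (M : QTM) (p : Polynomial ℕ), M.IsWellFormed ∧ M.amplitudes ⊆ S ∧
    ∀ x : List Bool, (x ∈ L → (2 / 3 : ℝ) ≤ M.acceptProbAt x (p.eval x.length)) ∧
      (x ∉ L → M.acceptProbAt x (p.eval x.length) ≤ (1 / 3 : ℝ))}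

/-- `BQP` defined via quantum Turing machines with polynomial-time computable amplitudes
(Bernstein–Vazirani 1997, §8). [cite: BernsteinVazirani1997, §8] -/
def BQPQTM : Set (Language Bool) := BQPQTMWith polyTimeComputableComplex

/-- `BQPQTMWith` is monotone in the amplitude set (immediate from the definition;
cf. Adleman–DeMarrais–Huang 1997). [cite: AdlemanDeMarraisHuang1997] -/
theorem BQPQTMWith_mono {S S' : Set ℂ} (h : S ⊆ S') : BQPQTMWith S ⊆ BQPQTMWith S' := by
  rintro L ⟨M, p, hwf, hamp, hL⟩
  exact ⟨M, p, hwf, hamp.trans h, hL⟩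

end Literature.Computability.Cryptography
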